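import Summits.CriticalPhenomena.SAWScalingLimit.Theorems.SAWRenewalTightnessConfinementPositivitySlabOfChain
import Summits.CriticalPhenomena.SAWScalingLimit.Theorems.SAWRenewalTightnessConfinementPositivityUnpinnedSlabTube
import Summits.CriticalPhenomena.SAWScalingLimit.Theorems.SAWRenewalTightnessConfinementPositivitySpanOne
import Literature.Probability.RandomPlanarGeometry.SAWWordBridges
import Literature.Probability.RandomPlanarGeometry.SAWCount
import HarnessLib

/-!
# Crux `ConfinementPositivity` (stmt-CriticalPhenomena-17587), line `Sketch` (sign-universality):
# stub Asm `stub_pinnedAssembly` — PinnedAtomCeiling → PinnedTubeFloor → SlabTubeConfinement'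

Registered stub Asm of the lead skeleton `Cruxes/ConfinementPositivity/Lines/Sketch.lean` (v4).  Kesten chains are
lists `l` of irreducible bridge words (pieces) weighted by `x_c ^ Σ|pieces|` (`x_c = criticalFugacity`); `u_n` is the
mass of the chains of total span `n`.  The two hypotheses are chain-level statements:

* `PinnedAtomCeiling`: the end height of a chain of span `n ≥ 1` has atoms `≤ (C/n)·u_n`;
* `PinnedTubeFloor`: for every aspect `α ≥ 1` there are `c_F > 0` and `W₀` such that for `W ≥ W₀`, `L ≤ αW`,
  `W ≤ α(L+1)`, `|y₀|, |y₁| ≤ W/2`, the chains of span `n = L + 1` started at height `y₀` that end at `y₁` inside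
  `|y| ≤ W` carry mass `≥ (c_F/n)·u_n`.

The conclusion `SlabTubeConfinement'` is stated over slab self-avoiding walks `(0, y₀) → (L, y₁)` in `0 ≤ x ≤ L`
(vertex functions, `Zd.sawFun`), comparing the tubes `|y| ≤ V` and `|y| ≤ W ≤ V` at two-sided bounded aspect.

## Proof

Write `M_X` for the mass of the chains of span `L + 1` from `y₀` pinned at `y₁` inside `|y| ≤ X`.
(A) Chain level, `ofReal c · M_V ≤ M_W` with `c = min (c_F/C) (x_c^{(α+2)(W₀+1)} / (αW₀+2))`:
* `W ≥ W₀`: `M_V ≤` (chains pinned at `y₁ - y₀`, no tube) `≤ (C/n) u_n` (monotonicity in the side condition,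
  `PinnedAsm.tsum_subtype_mono`; the ceiling), and `(c_F/n) u_n ≤ M_W` (the floor): ratio `c_F/C`
  (`PinnedAsm.main_regime`).
* `W < W₀`: `M_V ≤ u_n ≤ n + 1 ≤ αW₀ + 2` (`UnpinnedSlabTube.tsum_tsum_span_le` through
  `chainSpanMass_eq_tsum_tuples`), while `M_W ≥ x_c^{n + |y₁ - y₀|} ≥ x_c^{(α+2)(W₀+1)}`, the weight of the single
  explicit chain `[E·d^{|y₁-y₀|}, E, …, E]` (a vertical stick `vertWord d |y₁ - y₀|`, `d = ±e₁` towards `y₁`, followed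
  by `L` one-step east pieces), which climbs monotonically from `y₀` to `y₁` and then stays at `y₁`
  (`PinnedAsm.stick_lower`, `PinnedAsm.finite_regime`).
(B) Currency change, exactly as in the landed `stub_slabOfChain`: by `SlabOfChain.chain_eq_ofReal_slab` (Kesten's
factorisation), `M_X = ofReal (x_c · slab_X(N'))` for `N' + 2 ≥ (L+2)(2X+1)`; take `N' = N + (L+2)(2V+1)`, cancel
`x_c > 0` and use monotonicity of the slab partial sums in `N` (`SlabOfChain.slab_mono`).

Elementary over the tree; sources: H. Kesten, *On the number of self-avoiding walks*, J. Math. Phys. 4 (1963), §4;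
N. Madras, G. Slade, *The Self-Avoiding Walk* (1993), §4.2.  No `def`s, no new named facts.
-/

noncomputable section
open scoped BigOperators ENNReal
open Classical
open Literature.Probability.LatticeModels Literature.Probability.RandomPlanarGeometry
  Literature.Probability.RandomPlanarGeometry.SAW

namespace Summit.CriticalPhenomena.SAWScalingLimit.Theorems

namespace PinnedAsm

/-! ### Generic pieces: monotonicity of subtype sums, the two regimes in `ℝ≥0∞` -/

/-- In `ℝ≥0∞`, a `tsum` over a subtype is monotone in the defining predicate. [folklore] -/
theorem tsum_subtype_mono {β : Type*} {P Q : β → Prop} (g : β → ℝ≥0∞) (h : ∀ x, P x → Q x) :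
    ∑' x : {x // P x}, g x.1 ≤ ∑' x : {x // Q x}, g x.1 := by
  rw [chainTuples_tsum_subtype_eq_tsum_ite P g, chainTuples_tsum_subtype_eq_tsum_ite Q g]
  refine ENNReal.tsum_le_tsum fun x => ?_
  by_cases hP : P x
  · rw [if_pos hP, if_pos (h x hP)]
  · rw [if_neg hP]
    exact zero_le

/-- The main regime `W ≥ W₀`: `M_V ≤ P ≤ (C/n)·U` and `(c_F/n)·U ≤ M_W` give `(c_F/C)·M_V ≤ M_W`. [folklore] -/
theorem main_regime {MV MW P U : ℝ≥0∞} {C cF : ℝ} (n : ℕ) (hC : 0 < C) (hcF : 0 ≤ cF)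
    (h2 : P ≤ ENNReal.ofReal (C / n) * U) (h3 : ENNReal.ofReal (cF / n) * U ≤ MW) (h1 : MV ≤ P) :
    ENNReal.ofReal (cF / C) * MV ≤ MW := by
  have hC' : C ≠ 0 := hC.ne'
  calc ENNReal.ofReal (cF / C) * MV ≤ ENNReal.ofReal (cF / C) * (ENNReal.ofReal (C / n) * U) :=
        mul_le_mul' le_rfl (h1.trans h2)
    _ = ENNReal.ofReal (cF / C * (C / n)) * U := by
        rw [← mul_assoc, ENNReal.ofReal_mul (div_nonneg hcF hC.le)]
    _ = ENNReal.ofReal (cF / n) * U := by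
        rw [div_mul_div_comm, mul_comm cF C, mul_div_mul_left _ _ hC']
    _ ≤ MW := h3

/-- The finite regime `W < W₀`: `M_V ≤ U ≤ n + 1 ≤ B` and `x^k ≤ M_W` with `k ≤ e`, `0 ≤ x ≤ 1` give
`(x^e/B)·M_V ≤ M_W`. [folklore] -/
theorem finite_regime {MV MW U : ℝ≥0∞} {x : ℝ} {n e k B : ℕ} (hx0 : 0 ≤ x) (hx1 : x ≤ 1)
    (hk : k ≤ e) (hn : n + 1 ≤ B) (h3 : ENNReal.ofReal (x ^ k) ≤ MW) (h2 : U ≤ (n : ℝ≥0∞) + 1)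
    (h1 : MV ≤ U) : ENNReal.ofReal (x ^ e / B) * MV ≤ MW := by
  have hB : (B : ℝ) ≠ 0 := Nat.cast_ne_zero.2 (by omega)
  have hnB : (n : ℝ≥0∞) + 1 ≤ (B : ℝ≥0∞) := by exact_mod_cast hn
  calc ENNReal.ofReal (x ^ e / B) * MV ≤ ENNReal.ofReal (x ^ e / B) * (B : ℝ≥0∞) :=
        mul_le_mul' le_rfl (h1.trans (h2.trans hnB))
    _ = ENNReal.ofReal (x ^ e) := by
        rw [← ENNReal.ofReal_natCast B, ← ENNReal.ofReal_mul (div_nonneg (pow_nonneg hx0 _) (Nat.cast_nonneg _)),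
          div_mul_cancel₀ _ hB]
    _ ≤ ENNReal.ofReal (x ^ k) := ENNReal.ofReal_le_ofReal (pow_le_pow_of_le_one hx0 hx1 hk)
    _ ≤ MW := h3

/-- `u_n ≤ n + 1`: the total mass of the Kesten chains of span `n` is finite (every piece has span `≥ 1`, and each
level carries mass `≤ 1` by Kesten's identity; `UnpinnedSlabTube.tsum_tsum_span_le` in tuple form).
[cite: Kesten1963SAW, §4] -/
theorem total_le (n : ℕ) :
    (∑' l : {l : List (List Step) // (∀ w ∈ l, IsIrrBridge w) ∧ (l.map xEnd).sum = (n : ℤ) ∧ True},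
        ENNReal.ofReal (criticalFugacity ^ (l.1.map List.length).sum)) ≤ (n : ℝ≥0∞) + 1 := by
  rw [chainSpanMass_eq_tsum_tuples]
  simp only [and_true]
  exact UnpinnedSlabTube.tsum_tsum_span_le n

/-! ### The explicit chain `[E·d^m, E, …, E]` of the finite regime -/

/-- The direction of the stick: `d = +e₁` if `Δ ≥ 0`, `d = -e₁` if `Δ < 0`; then `|Δ| · dy d = Δ`. [folklore] -/
theorem exists_dir (Δ : ℤ) : ∃ d : Step, Step.dx d = 0 ∧ (Step.dy d = 1 ∨ Step.dy d = -1) ∧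
    (Δ.natAbs : ℤ) * Step.dy d = Δ := by
  rcases le_or_gt 0 Δ with hh | hh
  · exact ⟨1, rfl, Or.inl rfl, by rw [show Step.dy 1 = 1 from rfl, mul_one]; exact Int.natAbs_of_nonneg hh⟩
  · exact ⟨3, rfl, Or.inr rfl, by rw [show Step.dy 3 = -1 from rfl, mul_neg_one]; omega⟩

/-- Heights along the concatenation of `[E·d^m, E, …, E]` (`d` vertical): after `i` steps the height is
`(min i (m+1) - 1) · dy d` — it climbs by `dy d` per step for `1 ≤ i ≤ m + 1` and then stays. [folklore] -/
theorem stick_traj {d : Step} (hdx : Step.dx d = 0) (m L i : ℕ) :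
    traj (vertWord d m :: List.replicate L [(0 : Step)]).flatten i 1 = ((min i (m + 1) - 1 : ℕ) : ℤ) * Step.dy d := by
  rw [List.flatten_cons]
  rcases le_or_gt i (m + 1) with hi | hi
  · rw [traj_append_left _ _ (by rw [length_vertWord]; exact hi), min_eq_left hi]
    rcases i with _ | j
    · simp
    · rw [(traj_vertWord hdx m j (by omega)).2]
      simp
  · obtain ⟨j, rfl⟩ : ∃ j, i = (vertWord d m).length + j := ⟨i - (m + 1), by rw [length_vertWord]; omega⟩
    rw [traj_append_right, Pi.add_apply, length_vertWord, min_eq_right (by omega), spanOne_wEnd_vertWord hdx m,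
      UnpinnedSlabTube.traj_snd_eq_zero_of_forall_east _ _ j, add_zero]
    · simp
    · intro e he
      rw [List.mem_flatten] at he
      obtain ⟨l, hl, hel⟩ := he
      rw [List.eq_of_mem_replicate hl] at hel
      simpa using hel

/-- The tube bound along the stick: `|y₀ + j · dy d| ≤ W` for `j ≤ m`, `m · dy d = y₁ - y₀`,
`|y₀|, |y₁| ≤ W/2`. [folklore] -/
theorem stick_tube {W m j : ℕ} {y₀ y₁ s : ℤ} (hs : s = 1 ∨ s = -1) (hm : (m : ℤ) * s = y₁ - y₀) (hj : j ≤ m)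
    (hy₀ : 2 * |y₀| ≤ (W : ℤ)) (hy₁ : 2 * |y₁| ≤ (W : ℤ)) : |y₀ + (j : ℤ) * s| ≤ (W : ℤ) := by
  have h0 := le_abs_self y₀
  have h0' := neg_abs_le y₀
  have h1 := le_abs_self y₁
  have h1' := neg_abs_le y₁
  have hjm : (j : ℤ) ≤ m := by exact_mod_cast hj
  have hj0 : (0 : ℤ) ≤ j := Nat.cast_nonneg j
  rw [abs_le]
  rcases hs with rfl | rfl <;> constructor <;> linarith

/-- **The explicit chain.**  For `|y₀|, |y₁| ≤ W/2`, the chain `[E·d^{|y₁-y₀|}, E, …, E]` (`L` one-step east pieces)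
is a Kesten chain of span `L + 1` from `y₀` pinned at `y₁` inside `|y| ≤ W`, of weight `x_c^{L+1+|y₁-y₀|}`; hence
that weight is a lower bound for the pinned tube mass. [folklore] -/
theorem stick_lower (L W : ℕ) (y₀ y₁ : ℤ) (hy₀ : 2 * |y₀| ≤ (W : ℤ)) (hy₁ : 2 * |y₁| ≤ (W : ℤ)) :
    ENNReal.ofReal (criticalFugacity ^ (L + 1 + (y₁ - y₀).natAbs)) ≤
      ∑' l : {l : List (List Step) // (∀ w ∈ l, IsIrrBridge w) ∧ (l.map xEnd).sum = ((L + 1 : ℕ) : ℤ) ∧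
          (y₀ + wEnd l.flatten 1 = y₁ ∧ ∀ i, |y₀ + traj l.flatten i 1| ≤ (W : ℤ))},
        ENNReal.ofReal (criticalFugacity ^ (l.1.map List.length).sum) := by
  obtain ⟨d, hdx, hdy1, hm⟩ := exists_dir (y₁ - y₀)
  have hdy : Step.dy d ≠ 0 := by rcases hdy1 with h | h <;> rw [h] <;> norm_num
  set m := (y₁ - y₀).natAbs with hm_def
  set l₀ : List (List Step) := vertWord d m :: List.replicate L [(0 : Step)] with hl₀
  have hx1 : xEnd [(0 : Step)] = 1 := by decide
  have hP : (∀ w ∈ l₀, IsIrrBridge w) ∧ (l₀.map xEnd).sum = ((L + 1 : ℕ) : ℤ) ∧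
      (y₀ + wEnd l₀.flatten 1 = y₁ ∧ ∀ i, |y₀ + traj l₀.flatten i 1| ≤ (W : ℤ)) := by
    refine ⟨?_, ?_, ?_, ?_⟩
    · intro w hw
      rcases List.mem_cons.1 hw with rfl | hw
      · exact (isIrrBridge_vertWord hdx hdy m).1
      · rw [List.eq_of_mem_replicate hw]
        exact Renewal.isIrrBridge_single
    · simp only [hl₀, List.map_cons, List.sum_cons, List.map_replicate, List.sum_replicate, hx1,
        (isIrrBridge_vertWord hdx hdy m).2]
      push_cast
      ring
    · have hlen : m + 1 ≤ l₀.flatten.length := by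
        simp only [hl₀, List.flatten_cons, List.length_append, length_vertWord]
        omega
      rw [← traj_length, hl₀, stick_traj hdx, ← hl₀, min_eq_right hlen, Nat.add_sub_cancel, hm]
      ring
    · intro i
      rw [hl₀, stick_traj hdx]
      exact stick_tube hdy1 hm (by omega) hy₀ hy₁
  have hlen : (l₀.map List.length).sum = L + 1 + m := by
    simp only [hl₀, List.map_cons, List.sum_cons, List.map_replicate, List.sum_replicate, smul_eq_mul,
      length_vertWord, List.length_singleton]
    ring
  calc ENNReal.ofReal (criticalFugacity ^ (L + 1 + m))
      = ENNReal.ofReal (criticalFugacity ^ (l₀.map List.length).sum) := by rw [hlen]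
    _ ≤ _ := ENNReal.le_tsum (⟨l₀, hP⟩ : {l : List (List Step) // (∀ w ∈ l, IsIrrBridge w) ∧
          (l.map xEnd).sum = ((L + 1 : ℕ) : ℤ) ∧
            (y₀ + wEnd l.flatten 1 = y₁ ∧ ∀ i, |y₀ + traj l.flatten i 1| ≤ (W : ℤ))})

end PinnedAsm

open PinnedAsm in
/-- **Stub Asm `stub_pinnedAssembly`** (registered): PinnedAtomCeiling → PinnedTubeFloor → SlabTubeConfinement'.
Given `α`, let `C` be the ceiling constant and `(c_F, W₀)` the floor constants at aspect `α`; the constant is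
`c = min (c_F/C) (x_c^{(α+2)(W₀+1)}/(αW₀+2))`.  Chain level: for `W ≥ W₀` the `V`-tube pinned mass is at most the
pinned mass `≤ (C/n)u_n` and the `W`-tube pinned mass is `≥ (c_F/n)u_n`; for `W < W₀` the `V`-side is `≤ u_n ≤ n + 1`
and the `W`-side is `≥ x_c^{n+|y₁-y₀|}` (the chain `[E·d^{|y₁-y₀|}, E, …, E]`).  Slab level: Kesten's factorisation
`SlabOfChain.chain_eq_ofReal_slab` with `N' = N + (L+2)(2V+1)`. [cite: Kesten1963SAW, §4] -/
theorem stub_pinnedAssembly :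
    (∃ C : ℝ, 0 < C ∧ ∀ n : ℕ, 1 ≤ n → ∀ h : ℤ,
      (∑' l : {l : List (List Step) // (∀ w ∈ l, IsIrrBridge w) ∧ (l.map xEnd).sum = (n : ℤ) ∧
          wEnd l.flatten 1 = h},
        ENNReal.ofReal (criticalFugacity ^ (l.1.map List.length).sum)) ≤
        ENNReal.ofReal (C / n) *
          ∑' l : {l : List (List Step) // (∀ w ∈ l, IsIrrBridge w) ∧ (l.map xEnd).sum = (n : ℤ) ∧ True},
            ENNReal.ofReal (criticalFugacity ^ (l.1.map List.length).sum)) →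
    (∀ α : ℕ, 1 ≤ α → ∃ c : ℝ, 0 < c ∧ ∃ W₀ : ℕ, ∀ (L W : ℕ) (y₀ y₁ : ℤ), W₀ ≤ W → L ≤ α * W →
      W ≤ α * (L + 1) → 2 * |y₀| ≤ (W : ℤ) → 2 * |y₁| ≤ (W : ℤ) →
      ENNReal.ofReal (c / (L + 1 : ℕ)) *
          (∑' l : {l : List (List Step) // (∀ w ∈ l, IsIrrBridge w) ∧ (l.map xEnd).sum = ((L + 1 : ℕ) : ℤ) ∧ True},
            ENNReal.ofReal (criticalFugacity ^ (l.1.map List.length).sum)) ≤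
        ∑' l : {l : List (List Step) // (∀ w ∈ l, IsIrrBridge w) ∧ (l.map xEnd).sum = ((L + 1 : ℕ) : ℤ) ∧
            (y₀ + wEnd l.flatten 1 = y₁ ∧ ∀ i, |y₀ + traj l.flatten i 1| ≤ (W : ℤ))},
          ENNReal.ofReal (criticalFugacity ^ (l.1.map List.length).sum)) →
    (∀ α : ℕ, 1 ≤ α → ∃ c : ℝ, 0 < c ∧ ∀ (L W V : ℕ) (y₀ y₁ : ℤ), 1 ≤ W → W ≤ V → L ≤ α * W →
      W ≤ α * (L + 1) → 2 * |y₀| ≤ (W : ℤ) → 2 * |y₁| ≤ (W : ℤ) → ∀ N : ℕ, ∃ N' : ℕ,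
        c * (∑ n ∈ Finset.range (N + 1), ∑ _ω ∈ (Zd.sawFun 2 n ![(L : ℤ), y₁ - y₀]).filter
            (fun ω => ∀ i ≤ n, (0 : ℤ) ≤ ω i 0 ∧ ω i 0 ≤ (L : ℤ) ∧ |y₀ + ω i 1| ≤ (V : ℤ)), criticalFugacity ^ n) ≤
          (∑ n ∈ Finset.range (N' + 1), ∑ _ω ∈ (Zd.sawFun 2 n ![(L : ℤ), y₁ - y₀]).filter
            (fun ω => ∀ i ≤ n, (0 : ℤ) ≤ ω i 0 ∧ ω i 0 ≤ (L : ℤ) ∧ |y₀ + ω i 1| ≤ (W : ℤ)), criticalFugacity ^ n)) := by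
  intro hceil hfloor α hα
  obtain ⟨C, hC, hceil⟩ := hceil
  obtain ⟨cF, hcF, W₀, hfloor⟩ := hfloor α hα
  have hxc := StripMass.criticalFugacity_pos
  have hx1 : criticalFugacity ≤ 1 := criticalFugacity_le_half.trans (by norm_num)
  refine ⟨min (cF / C) (criticalFugacity ^ ((α + 2) * (W₀ + 1)) / ((α * W₀ + 2 : ℕ) : ℝ)),
    lt_min (div_pos hcF hC) (div_pos (pow_pos hxc _) (by positivity)), ?_⟩
  intro L W V y₀ y₁ hW hWV hL hWL hy₀ hy₁ N
  set c : ℝ := min (cF / C) (criticalFugacity ^ ((α + 2) * (W₀ + 1)) / ((α * W₀ + 2 : ℕ) : ℝ)) with hc_def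
  have hc : 0 < c := lt_min (div_pos hcF hC) (div_pos (pow_pos hxc _) (by positivity))
  -- (A) the chain-level inequality
  have key : ENNReal.ofReal c *
      (∑' l : {l : List (List Step) // (∀ w ∈ l, IsIrrBridge w) ∧ (l.map xEnd).sum = ((L + 1 : ℕ) : ℤ) ∧
          (y₀ + wEnd l.flatten 1 = y₁ ∧ ∀ i, |y₀ + traj l.flatten i 1| ≤ (V : ℤ))},
        ENNReal.ofReal (criticalFugacity ^ (l.1.map List.length).sum)) ≤
      ∑' l : {l : List (List Step) // (∀ w ∈ l, IsIrrBridge w) ∧ (l.map xEnd).sum = ((L + 1 : ℕ) : ℤ) ∧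
          (y₀ + wEnd l.flatten 1 = y₁ ∧ ∀ i, |y₀ + traj l.flatten i 1| ≤ (W : ℤ))},
        ENNReal.ofReal (criticalFugacity ^ (l.1.map List.length).sum) := by
    rcases le_or_gt W₀ W with hW₀ | hW₀
    · refine le_trans (mul_le_mul' (ENNReal.ofReal_le_ofReal (min_le_left _ _)) le_rfl) ?_
      exact main_regime (L + 1) hC hcF.le (hceil (L + 1) (Nat.succ_pos L) (y₁ - y₀))
        (hfloor L W y₀ y₁ hW₀ hL hWL hy₀ hy₁)
        (tsum_subtype_mono (fun l : List (List Step) => ENNReal.ofReal (criticalFugacity ^ (l.map List.length).sum))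
          fun l hl => ⟨hl.1, hl.2.1, by rw [← hl.2.2.1]; ring⟩)
    · refine le_trans (mul_le_mul' (ENNReal.ofReal_le_ofReal (min_le_right _ _)) le_rfl) ?_
      have hαW : α * (W + 1) ≤ α * W₀ := Nat.mul_le_mul_left α hW₀
      have ha₀ := abs_nonneg y₀
      have hΔ : ((y₁ - y₀).natAbs : ℤ) ≤ W := by
        rw [Int.natCast_natAbs]
        calc |y₁ - y₀| ≤ |y₁| + |y₀| := abs_sub _ _
          _ ≤ W := by linarith
      have hΔ' : (y₁ - y₀).natAbs ≤ W := by exact_mod_cast hΔ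
      have hk : L + 1 + (y₁ - y₀).natAbs ≤ (α + 2) * (W₀ + 1) := by
        have e : (α + 2) * (W₀ + 1) = α * W₀ + α + 2 * W₀ + 2 := by ring
        have e' : α * (W + 1) = α * W + α := by ring
        omega
      have hn : L + 1 + 1 ≤ α * W₀ + 2 := by
        have e' : α * (W + 1) = α * W + α := by ring
        omega
      exact finite_regime hxc.le hx1 hk hn (stick_lower L W y₀ y₁ hy₀ hy₁) (total_le (L + 1))
        (tsum_subtype_mono (fun l : List (List Step) => ENNReal.ofReal (criticalFugacity ^ (l.map List.length).sum))
          fun l hl => ⟨hl.1, hl.2.1, trivial⟩)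
  -- (B) chain currency → slab currency (Kesten's factorisation, landed as `SlabOfChain.chain_eq_ofReal_slab`)
  have hWV' : (W : ℤ) ≤ (V : ℤ) := by exact_mod_cast hWV
  have ha := abs_nonneg y₀
  have hy₀W : |y₀| ≤ (W : ℤ) := by linarith
  have hy₀V : |y₀| ≤ (V : ℤ) := by linarith
  refine ⟨N + (L + 2) * (2 * V + 1), ?_⟩
  have hMV : (L + 2) * (2 * V + 1) ≤ N + (L + 2) * (2 * V + 1) + 2 :=
    (Nat.le_add_left _ _).trans (Nat.le_add_right _ _)
  have hMW : (L + 2) * (2 * W + 1) ≤ N + (L + 2) * (2 * V + 1) + 2 :=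
    (Nat.mul_le_mul_left _ (by omega)).trans hMV
  rw [SlabOfChain.chain_eq_ofReal_slab L V y₀ y₁ hy₀V _ hMV,
    SlabOfChain.chain_eq_ofReal_slab L W y₀ y₁ hy₀W _ hMW, ← ENNReal.ofReal_mul hc.le,
    ENNReal.ofReal_le_ofReal_iff (mul_nonneg hxc.le (SlabOfChain.slab_nonneg L W y₀ y₁ _)),
    mul_left_comm] at key
  exact (mul_le_mul_of_nonneg_left (SlabOfChain.slab_mono L V y₀ y₁ (Nat.le_add_right N _)) hc.le).trans
    (le_of_mul_le_mul_left key hxc)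

end Summit.CriticalPhenomena.SAWScalingLimit.Theorems

end
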